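import Summits.ResolutionOfSingularities.ResolutionOfSingularities.Theorems.FrobeniusLadderFInjectiveMacaulayficationBlowupChartLocalization
import Summits.ResolutionOfSingularities.ResolutionOfSingularities.Theorems.FrobeniusLadderFInjectiveMacaulayficationSemiLocalScheme
import Summits.ResolutionOfSingularities.ResolutionOfSingularities.Theorems.FrobeniusLadderFInjectiveMacaulayficationSpreadMulti
import Summits.ResolutionOfSingularities.ResolutionOfSingularities.Theorems.FrobeniusLadderFInjectiveMacaulayficationClusterGrowthStepDimThree
import HarnessLib

/-!
# `clusterGrowth_multi`: the SIMULTANEOUS dominating cure at finitely many points of local dimension ≤ 3 (semi-local Cossart–Piltant)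
# (crux `FInjectiveMacaulayfication` stmt-ResolutionOfSingularities-15315, chain w45a; res-L1-w45a-plan-1 RULING R16.54 (2)/R16.55 (1)/R16.56 =
# res-L1-w45a-tri-2's replacement 22:34:36Z of the over-claiming iterate: «each ROUND cures all current maximal bad points of loc dim ≤ 3 at once»;
# seat res-L1-w45a-stub-1 g7, on res-L1-w45a-stub-3's `…SemiLocalScheme` and res-L1-w45a-stub-2's `…SpreadMulti`)

[OURS · L1 W4.5a] Support file (`--supports stmt-ResolutionOfSingularities-15315 --as helper`); replaces the role of NO printed item — hole-#3 bookkeeping of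
OURS; NOT a statement of the manuscript; def-free; THEOREMS modulo printed results BY NAME (`CossartPiltant2019General` = CP 2019 Thm. 1.1 (i)(ii),
`Stacks081R` = Raynaud–Gruson 5.2.2, `CossartPiltant2019Principalization` = CP 2019 Prop. 4.4, and for the cure `NonFullLocusClosed` = Datta–Murayama 2024
Thm. B + EGA IV₂ 6.11.2); AI-written (AI review is weaker than expert review).

* §1 plumbing (`goodOver_iUnion`, sections of a nonzero ideal sheaf are nonzero).
* §2 RING LEVEL. `exists_semiLocal_fix (hG h081R hP)`: `R` a quasi-excellent Noetherian domain, `P ≠ ∅` finitely many primes, `S` the semi-local ring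
  (`[IsLocalization (⨅ p ∈ P, p.primeCompl) S]`) of dimension `3`, `I₀ ≠ ⊥` an ideal of `R`: there are `𝔮 ≠ ⊥ ⊆ S` and generators `g` of `I₀S · 𝔮`
  with every chart `S[(g)/g_j]` REGULAR at every prime and `V(𝔮) ⊆ Sing(Spec S) ∪ NonPrinc(I₀S)` (the supported (b1)
  `DominatingLocFixRegularSupported.exists_isBlowup_mul_isRegular_of_dim_three_supported'` on `Spec S`, read in the ring by
  `BlowupChartLocalization`). `semiLocal_fix_atPrime`: at each `p ∈ P`, for ANY local ring `B` of `R` at `p`, the images `d = φ ∘ g` generate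
  `I₀B · 𝔮₀B` (`𝔮₀ = 𝔮 ∩ R`), every chart `B[(d)/d_j]` is regular at every prime, and `V(𝔮₀B) ⊆ Sing(Spec B) ∪ NonPrinc(I₀B)` — `B` is a
  localisation of `S` (`SemiLocalScheme.isLocalization_map_primeCompl`) and everything descends (`BlowupChartLocalization`).
* §3 SCHEME LEVEL. `exists_semiLocal_productCompatible_locFix (hG h081R hP)`: `X₁` integral, locally of finite type over `k` (`char p`), `ζ₁…ζ_m` in
  ONE affine open `U₀`, all of local dimension `≤ 3` and one of local dimension `3`: ONE ideal `𝔮₀ ≠ ⊥` of `Γ(X₁, U₀)` such that at EVERY `ζᵢ` the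
  product `J₀,ζᵢ · 𝔮₀𝒪_ζᵢ` has generators all of whose affine blow-up charts are REGULAR and FULL at every prime, with the support clause
  `V(𝔮₀𝒪_ζᵢ) ⊆ Sing ∪ NonPrinc(J₀,ζᵢ)`.
* §4 **`clusterGrowth_multi (hG h081R hP hNF)`** (ARENA FORM): for `J₀ ≠ ⊥` good over `S`, such `ζ₁…ζ_m ∈ U₀`, and any closed STABLE ARENA
  `T ⊇ Sing X₁ ∪ NonPrinc J₀`: ONE auxiliary centre `J″ ≠ ⊥` with `supp J″ ⊆ T` and ONE open `U ∋ ζ₁,…,ζ_m` such that every blowing up along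
  `J₀ · J″` is FULL over `U` and `GoodOver p X₁ (J₀ · J″) ((S ∖ T) ∪ U)` — stub-2's multi-point spread of `𝔮₀` with support in `T`
  (`SpreadMulti.exists_spread_multi`, `hrad` by `ClusterGrowthStepDimThree.hrad_of_support_clause`), `DominatingLocFix.goodOver_nhd_of_locGood` at
  each `ζᵢ`, base locality `GoodOverMul.goodOver_mul_diff_support` off `T ⊇ supp J″`, unions. (+ `_of_named` from the five printed theorems.)
WHY (R16.54): the unit the termination analysis counts in — new bad set `⊆ (old ∖ U) ∪ (T ∖ U)` after one ROUND; it makes the sequential iterate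
(which can undo earlier cures) unnecessary. NOT COVERED: all `ζᵢ` of local dimension `≤ 2` (the semi-local ring then has dimension `≤ 2`, outside
CP 2019 Prop. 4.4) — flagged.
[cite: CossartPiltant2019, Thm. 1.1 (i)(ii); Prop. 4.4] [cite: RaynaudGruson1971, Thm. 5.2.2] [cite: DattaMurayama2024, Thm. B]
[cite: StacksProject, Tag 0804; Tag 0805; Tag 01J7] [cite: Matsumura1987, Thm. 4.3]
-/

-- single-problem summit: the doubled namespace component is forced
set_option linter.dupNamespace false

noncomputable section

namespace Summit.ResolutionOfSingularities.ResolutionOfSingularities.Theorems.FInjectiveMacaulayfication.ClusterGrowthMulti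

open CategoryTheory CategoryTheory.Limits AlgebraicGeometry TopologicalSpace IsLocalRing
open Literature.AlgebraicGeometry.Resolution
open Summit.ResolutionOfSingularities.ResolutionOfSingularities.Theorems.FInjectiveMacaulayfication
open SliceableCentre FCUnguardedAprime
open Scheme.IdealSheafData

/-! ## §1 Plumbing -/

/-- `GoodOver` over a union of any family. [plumbing] -/
theorem goodOver_iUnion {X₁ : Scheme.{0}} {p : ℕ} {J : X₁.IdealSheafData} {ι : Type*} {S : ι → Set X₁}
    (h : ∀ i, GoodOver p X₁ J (S i)) : GoodOver p X₁ J (⋃ i, S i) := fun X₂ π hπ =>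
  ⟨fun x hx hxcl => by
      obtain ⟨i, hi⟩ := Set.mem_iUnion.mp hx
      exact (h i X₂ π hπ).1 x hi hxcl,
    fun x hx hxcl => by
      obtain ⟨i, hi⟩ := Set.mem_iUnion.mp hx
      exact (h i X₂ π hπ).2 x hi hxcl⟩

/-- On an integral scheme the sections of a nonzero ideal sheaf over an affine open containing a point are nonzero. [plumbing] -/
theorem ideal_ne_bot_of_ne_bot {X₁ : Scheme.{0}} [IsIntegral X₁] {J : X₁.IdealSheafData} (hJ : J ≠ ⊥) (U : X₁.affineOpens) {x : X₁}
    (hx : x ∈ (U : X₁.Opens)) : J.ideal U ≠ ⊥ := by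
  intro h0
  apply stalkIdeal_ne_bot_of_ne_bot hJ x
  rw [stalkIdeal_eq_map_germ J U hx, h0, Ideal.map_bot]

/-! ## §2 Ring level: the semi-local product-compatible regular fix and its reading at each prime -/

set_option maxHeartbeats 400000 in
-- the `𝔟 = 𝔮~` bookkeeping on `Spec S` elaborates large terms (as in `DominatingLocFixLocalSupported`)
/-- **The semi-local product-compatible regular fix, ring form.** `R` a quasi-excellent Noetherian domain, `P ≠ ∅` a finite set of primes, `S` its
semi-local ring, of dimension `3`, `I₀ ≠ ⊥ ⊆ R`: there are `𝔮 ≠ ⊥ ⊆ S` and generators `g` of `I₀S · 𝔮` such that every chart `S[(g)/g_j]` is regular at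
every prime and every prime `Q ⊇ 𝔮` of `S` has `S_Q` non-regular or `I₀ S_Q` non-principal. [OURS · conditional-result]
[cite: CossartPiltant2019, Thm. 1.1 (i)(ii); Prop. 4.4] [cite: StacksProject, Tag 0804] -/
theorem exists_semiLocal_fix
    (hG : CossartPiltant2019General.{0}) (h081R : Stacks081R.{0}) (hP4 : CossartPiltant2019Principalization.{0})
    {R : Type} [CommRing R] [IsDomain R] [IsNoetherianRing R] (hR : IsQuasiExcellentRing R)
    (P : Finset (PrimeSpectrum R)) (hP : P.Nonempty)
    (S : Type) [CommRing S] [Algebra R S] [IsLocalization (⨅ p ∈ P, p.asIdeal.primeCompl : Submonoid R) S]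
    (hdim : ringKrullDim S = 3) (I₀ : Ideal R) (hI₀ : I₀ ≠ ⊥) :
    ∃ (𝔮 : Ideal S) (n : ℕ) (g : Fin n → S), 𝔮 ≠ ⊥ ∧ Ideal.span (Set.range g) = I₀.map (algebraMap R S) * 𝔮 ∧
      (∀ (j : Fin n) (𝔔 : PrimeSpectrum (blowupAlgebra (Ideal.span (Set.range g)) (g j))),
        IsRegularLocalRing (Localization.AtPrime 𝔔.asIdeal)) ∧
      ∀ Q : PrimeSpectrum S, 𝔮 ≤ Q.asIdeal →
        ¬ IsRegularLocalRing (Localization.AtPrime Q.asIdeal) ∨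
        ¬ ((I₀.map (algebraMap R S)).map (algebraMap S (Localization.AtPrime Q.asIdeal))).IsPrincipal := by
  classical
  haveI := SemiLocalScheme.isIntegral_Spec P S hP
  haveI := SemiLocalScheme.isNoetherian_Spec (R := R) P S
  haveI : IsDomain S := SemiLocalScheme.isDomain P S hP
  haveI : IsNoetherianRing S := IsLocalization.isNoetherianRing (⨅ p ∈ P, p.asIdeal.primeCompl : Submonoid R) S inferInstance
  have hqe : Scheme.IsQuasiExcellent (Spec (.of S)) := SemiLocalScheme.isQuasiExcellent_Spec P S hR
  have hdimS : topologicalKrullDim (Spec (.of S)) = 3 := by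
    change topologicalKrullDim (PrimeSpectrum S) = 3
    rw [PrimeSpectrum.topologicalKrullDim_eq_ringKrullDim, hdim]
  -- `I₀ S ≠ ⊥`
  have hinj : Function.Injective (algebraMap R S) :=
    IsLocalization.injective S (SemiLocalScheme.iInf_primeCompl_le_nonZeroDivisors P hP)
  have hI : I₀.map (algebraMap R S) ≠ ⊥ := by
    intro h0
    apply hI₀
    rw [eq_bot_iff]
    intro x hx
    have hx' : algebraMap R S x ∈ I₀.map (algebraMap R S) := Ideal.mem_map_of_mem _ hx
    rw [h0, Ideal.mem_bot] at hx'
    exact (map_eq_zero_iff _ hinj).mp hx'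
  -- the SUPPORTED scheme-level product-compatible resolution on `Spec S` applied to `(I₀S)~`
  obtain ⟨𝔟, h𝔟, hsupp, -, hall⟩ :=
    DominatingLocFixRegularSupported.exists_isBlowup_mul_isRegular_of_dim_three_supported' hG h081R hP4 hqe hdimS
      (affineBlowup.idealSheaf (I₀.map (algebraMap R S))) (affineBlowup.idealSheaf_ne_bot hI)
  -- `𝔟 = 𝔮~`
  let eΓ := Scheme.ΓSpecIso (.of S)
  let 𝔮 : Ideal S := (𝔟.ideal ⟨⊤, isAffineOpen_top _⟩).map eΓ.hom.hom
  have hcomp : eΓ.inv.hom.comp eΓ.hom.hom = RingHom.id _ := by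
    rw [← CommRingCat.hom_comp, Iso.hom_inv_id, CommRingCat.hom_id]
  have h𝔮map : 𝔮.map eΓ.inv.hom = 𝔟.ideal ⟨⊤, isAffineOpen_top _⟩ := by
    rw [Ideal.map_map, hcomp, Ideal.map_id]
  have h𝔟eq : affineBlowup.idealSheaf 𝔮 = 𝔟 := by
    apply Scheme.IdealSheafData.ext_of_isAffine
    rw [affineBlowup.idealSheaf, ideal_ofIdealTop_top, h𝔮map]
  have h𝔮0 : 𝔮 ≠ ⊥ := by
    intro h0
    apply h𝔟
    rw [← h𝔟eq, h0]
    apply Scheme.IdealSheafData.ext_of_isAffine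
    rw [affineBlowup.idealSheaf, ideal_ofIdealTop_top, Ideal.map_bot, Scheme.IdealSheafData.ideal_bot, Pi.bot_apply]
  have hprod : affineBlowup.idealSheaf (I₀.map (algebraMap R S)) * 𝔟 = affineBlowup.idealSheaf (I₀.map (algebraMap R S) * 𝔮) := by
    rw [affineBlowup.idealSheaf_mul, h𝔟eq]
  -- generators of `I₀S · 𝔮`; the affine blowing up along them is a blowing up along `(I₀S)~ · 𝔟`, hence regular
  obtain ⟨n, g, hg⟩ := Submodule.fg_iff_exists_fin_generating_family.mp (IsNoetherian.noetherian (I₀.map (algebraMap R S) * 𝔮))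
  have hg' : Ideal.span (Set.range g) = I₀.map (algebraMap R S) * 𝔮 := hg
  have hreg : Scheme.IsRegular (affineBlowup (Ideal.span (Set.range g))) := by
    refine hall _ (affineBlowup.π (Ideal.span (Set.range g))) ?_
    rw [hprod, ← hg']
    exact affineBlowup.isBlowup _
  rw [← h𝔟eq] at hsupp
  exact ⟨𝔮, n, g, h𝔮0, hg', fun j 𝔔 => BlowupChartLocalization.isRegularLocalRing_chart_of_isRegular_affineBlowup g hreg j 𝔔,
    fun Q hQ => BlowupChartLocalization.support_clause_of_support_subset 𝔮 (I₀.map (algebraMap R S)) hsupp Q hQ⟩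

/-- **The semi-local fix read at ONE prime `p ∈ P`, in ANY local ring `B` of `R` at `p`** (e.g. a stalk): the images `d = φ ∘ g` generate
`I₀B · 𝔮₀B` (`𝔮₀ = 𝔮 ∩ R`), every chart `B[(d)/d_j]` is regular at every prime, and every prime `P′ ⊇ 𝔮₀B` of `B` has `B_{P′}` non-regular or
`I₀ B_{P′}` non-principal — `B` is a localisation of `S` and everything descends (`BlowupChartLocalization`). [folklore transfer]
[cite: StacksProject, Tag 0805] [cite: Matsumura1987, Thm. 4.3] -/
theorem semiLocal_fix_atPrime {R : Type} [CommRing R] (P : Finset (PrimeSpectrum R))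
    (S : Type) [CommRing S] [Algebra R S] [IsLocalization (⨅ p ∈ P, p.asIdeal.primeCompl : Submonoid R) S]
    {𝔮 : Ideal S} {n : ℕ} {g : Fin n → S} {I₀ : Ideal R}
    (hg : Ideal.span (Set.range g) = I₀.map (algebraMap R S) * 𝔮)
    (hreg : ∀ (j : Fin n) (𝔔 : PrimeSpectrum (blowupAlgebra (Ideal.span (Set.range g)) (g j))),
      IsRegularLocalRing (Localization.AtPrime 𝔔.asIdeal))
    (hV : ∀ Q : PrimeSpectrum S, 𝔮 ≤ Q.asIdeal →
      ¬ IsRegularLocalRing (Localization.AtPrime Q.asIdeal) ∨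
      ¬ ((I₀.map (algebraMap R S)).map (algebraMap S (Localization.AtPrime Q.asIdeal))).IsPrincipal)
    {p : PrimeSpectrum R} (hp : p ∈ P) (B : Type) [CommRing B] [Algebra R B] [IsLocalization.AtPrime B p.asIdeal] :
    ∃ d : Fin n → B, Ideal.span (Set.range d) = I₀.map (algebraMap R B) * (𝔮.under R).map (algebraMap R B) ∧
      (∀ (j : Fin n) (𝔔' : PrimeSpectrum (blowupAlgebra (Ideal.span (Set.range d)) (d j))),
        IsRegularLocalRing (Localization.AtPrime 𝔔'.asIdeal)) ∧
      ∀ P' : PrimeSpectrum B, (𝔮.under R).map (algebraMap R B) ≤ P'.asIdeal →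
        ¬ IsRegularLocalRing (Localization.AtPrime P'.asIdeal) ∨
        ¬ ((I₀.map (algebraMap R B)).map (algebraMap B (Localization.AtPrime P'.asIdeal))).IsPrincipal := by
  letI : Algebra S B := IsLocalization.localizationAlgebraOfSubmonoidLe S B (⨅ p ∈ P, p.asIdeal.primeCompl : Submonoid R)
    p.asIdeal.primeCompl (SemiLocalScheme.iInf_primeCompl_le P hp)
  haveI : IsScalarTower R S B := IsLocalization.localization_isScalarTower_of_submonoid_le S B
    (⨅ p ∈ P, p.asIdeal.primeCompl : Submonoid R) p.asIdeal.primeCompl (SemiLocalScheme.iInf_primeCompl_le P hp)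
  haveI : IsLocalization ((p.asIdeal.primeCompl).map (algebraMap R S)) B := SemiLocalScheme.isLocalization_map_primeCompl P S hp B
  have h𝔮 : (𝔮.under R).map (algebraMap R S) = 𝔮 := IsLocalization.map_under (⨅ p ∈ P, p.asIdeal.primeCompl : Submonoid R) S 𝔮
  have hRB : algebraMap R B = (algebraMap S B).comp (algebraMap R S) := IsScalarTower.algebraMap_eq R S B
  refine ⟨algebraMap S B ∘ g, ?_, fun j 𝔔' => ?_, fun P' hP' => ?_⟩
  · rw [BlowupChartLocalization.span_range_comp_eq_map, hg, Ideal.map_mul, hRB, ← Ideal.map_map, ← Ideal.map_map, h𝔮]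
  · exact BlowupChartLocalization.forall_isRegularLocalRing_chart_localization ((p.asIdeal.primeCompl).map (algebraMap R S)) g hreg j 𝔔'
  · have hP'' : 𝔮.map (algebraMap S B) ≤ P'.asIdeal := by rwa [hRB, ← Ideal.map_map, h𝔮] at hP'
    have h := BlowupChartLocalization.support_clause_localization ((p.asIdeal.primeCompl).map (algebraMap R S)) 𝔮
      (I₀.map (algebraMap R S)) hV P' hP''
    rw [hRB, ← Ideal.map_map]
    exact h

/-! ## §3 Scheme level: the semi-local product-compatible fix at finitely many points of one affine open -/

set_option maxHeartbeats 400000 in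
-- stalk algebra instances and the `CharP` transport elaborate large terms
/-- **The semi-local product-compatible regular fix at finitely many points `ζ₁,…,ζ_m` of ONE affine open `U₀`** (`X₁` integral, locally of
finite type over `k` of characteristic `p`; all `dim 𝒪_{ζᵢ} ≤ 3`, one `= 3`): ONE ideal `𝔮₀ ≠ ⊥` of `Γ(X₁, U₀)` such that at EVERY `ζᵢ` the product
`J₀,ζᵢ · 𝔮₀𝒪_{ζᵢ}` has generators all of whose affine blow-up charts are REGULAR and FULL at every prime, and `V(𝔮₀𝒪_{ζᵢ}) ⊆ Sing ∪ NonPrinc(J₀,ζᵢ)`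
in `Spec 𝒪_{ζᵢ}`. Modulo CP 2019 Thm. 1.1 + Raynaud–Gruson + CP 2019 Prop. 4.4 BY NAME, applied ONCE on the semi-local scheme. [OURS · conditional-result]
[cite: CossartPiltant2019, Thm. 1.1 (i)(ii); Prop. 4.4] [cite: StacksProject, Tag 0804; Tag 0805] [cite: Matsumura1987, Thm. 4.3] -/
theorem exists_semiLocal_productCompatible_locFix
    (hG : CossartPiltant2019General.{0}) (h081R : Stacks081R.{0}) (hP4 : CossartPiltant2019Principalization.{0})
    (p : ℕ) [hp : Fact p.Prime] {k : Type} [Field k] [CharP k p] {X₁ : Scheme.{0}} (f₁ : X₁ ⟶ Spec (.of k))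
    [LocallyOfFiniteType f₁] [IsIntegral X₁]
    {m : ℕ} (ζs : Fin m → X₁) (U₀ : X₁.affineOpens) (hζ : ∀ i, ζs i ∈ (U₀ : X₁.Opens))
    (hle : ∀ i, ringKrullDim (X₁.presheaf.stalk (ζs i)) ≤ 3) (h3 : ∃ i, ringKrullDim (X₁.presheaf.stalk (ζs i)) = 3)
    (J₀ : X₁.IdealSheafData) (hJ₀ : J₀ ≠ ⊥) :
    ∃ 𝔮₀ : Ideal Γ(X₁, U₀), 𝔮₀ ≠ ⊥ ∧ ∀ i : Fin m,
      (∃ (n : ℕ) (d : Fin n → X₁.presheaf.stalk (ζs i)),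
        Ideal.span (Set.range d) = stalkIdeal J₀ (ζs i) * 𝔮₀.map (X₁.presheaf.germ U₀ (ζs i) (hζ i)).hom ∧
        ∀ (j : Fin n) (𝔔 : PrimeSpectrum (blowupAlgebra (Ideal.span (Set.range d)) (d j))),
          IsRegularLocalRing (Localization.AtPrime 𝔔.asIdeal) ∧ FullCl p (Localization.AtPrime 𝔔.asIdeal)) ∧
      ∀ P' : PrimeSpectrum (X₁.presheaf.stalk (ζs i)), 𝔮₀.map (X₁.presheaf.germ U₀ (ζs i) (hζ i)).hom ≤ P'.asIdeal →
        ¬ IsRegularLocalRing (Localization.AtPrime P'.asIdeal) ∨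
        ¬ ((stalkIdeal J₀ (ζs i)).map (algebraMap (X₁.presheaf.stalk (ζs i)) (Localization.AtPrime P'.asIdeal))).IsPrincipal := by
  classical
  haveI : IsLocallyNoetherian X₁ := LocallyOfFiniteType.isLocallyNoetherian f₁
  obtain ⟨i₀, hi₀⟩ := h3
  -- `R := Γ(X₁, U₀)`: Noetherian quasi-excellent domain
  haveI : Nonempty (U₀ : X₁.Opens) := ⟨⟨ζs i₀, hζ i₀⟩⟩
  haveI : IsDomain Γ(X₁, U₀) := IsIntegral.component_integral _
  haveI : IsNoetherianRing Γ(X₁, U₀) := IsLocallyNoetherian.component_noetherian U₀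
  have hqX : Scheme.IsQuasiExcellent X₁ := Scheme.isQuasiExcellent_of_locallyOfFiniteType Stacks07QW_field_holds f₁
  have hR : IsQuasiExcellentRing Γ(X₁, U₀) := hqX U₀
  -- the primes of the `ζs` and the semi-local ring
  let 𝔭 : Fin m → PrimeSpectrum Γ(X₁, U₀) := fun i => U₀.2.primeIdealOf ⟨ζs i, hζ i⟩
  let P : Finset (PrimeSpectrum Γ(X₁, U₀)) := Finset.univ.image 𝔭
  have h𝔭P : ∀ i, 𝔭 i ∈ P := fun i => Finset.mem_image_of_mem 𝔭 (Finset.mem_univ i)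
  have hPne : P.Nonempty := ⟨𝔭 i₀, h𝔭P i₀⟩
  let S : Type := Localization (⨅ q ∈ P, q.asIdeal.primeCompl : Submonoid Γ(X₁, U₀))
  -- the stalks are local rings of `R` at the `𝔭 i`
  letI algB : ∀ i, Algebra Γ(X₁, U₀) (X₁.presheaf.stalk (ζs i)) := fun i => (X₁.presheaf.germ U₀ (ζs i) (hζ i)).hom.toAlgebra
  haveI hloc : ∀ i, IsLocalization.AtPrime (X₁.presheaf.stalk (ζs i)) (𝔭 i).asIdeal := fun i =>
    U₀.2.isLocalization_stalk ⟨ζs i, hζ i⟩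
  have hgerm : ∀ i, algebraMap Γ(X₁, U₀) (X₁.presheaf.stalk (ζs i)) = (X₁.presheaf.germ U₀ (ζs i) (hζ i)).hom := fun i => rfl
  -- `dim S = 3`
  have hdimloc : ∀ i, ringKrullDim (Localization.AtPrime (𝔭 i).asIdeal) = ringKrullDim (X₁.presheaf.stalk (ζs i)) := fun i => by
    rw [IsLocalization.AtPrime.ringKrullDim_eq_height (𝔭 i).asIdeal (Localization.AtPrime (𝔭 i).asIdeal),
      IsLocalization.AtPrime.ringKrullDim_eq_height (𝔭 i).asIdeal (X₁.presheaf.stalk (ζs i))]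
  have hdim : ringKrullDim S = 3 := by
    apply le_antisymm
    · refine SemiLocalScheme.ringKrullDim_le_of_forall P S 3 fun q hq => ?_
      obtain ⟨i, -, rfl⟩ := Finset.mem_image.mp hq
      rw [hdimloc i]
      exact hle i
    · rw [← hi₀, ← hdimloc i₀]
      exact SemiLocalScheme.le_ringKrullDim_of_mem P S (h𝔭P i₀)
  -- the semi-local fix for `I₀ := J₀(U₀)`
  obtain ⟨𝔮, n, g, h𝔮0, hg, hreg, hV⟩ :=
    exists_semiLocal_fix hG h081R hP4 hR P hPne S hdim (J₀.ideal U₀) (ideal_ne_bot_of_ne_bot hJ₀ U₀ (hζ i₀))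
  refine ⟨𝔮.under Γ(X₁, U₀), ?_, fun i => ?_⟩
  · intro h0
    apply h𝔮0
    rw [← IsLocalization.map_under (⨅ q ∈ P, q.asIdeal.primeCompl : Submonoid Γ(X₁, U₀)) S 𝔮, h0, Ideal.map_bot]
  · obtain ⟨d, hd, hregB, hVB⟩ := semiLocal_fix_atPrime P S hg hreg hV (h𝔭P i) (X₁.presheaf.stalk (ζs i))
    have hJ : (J₀.ideal U₀).map (algebraMap Γ(X₁, U₀) (X₁.presheaf.stalk (ζs i))) = stalkIdeal J₀ (ζs i) := by
      rw [hgerm, ← stalkIdeal_eq_map_germ]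
    refine ⟨⟨n, d, by rw [hd, hJ, hgerm], fun j 𝔔 => ⟨hregB j 𝔔, ?_⟩⟩, fun P' hP' => ?_⟩
    · haveI : CharP (Localization.AtPrime 𝔔.asIdeal) p :=
        CharP.of_ringHom_of_ne_zero
          ((algebraMap (blowupAlgebra (Ideal.span (Set.range d)) (d j)) (Localization.AtPrime 𝔔.asIdeal)).comp
            ((algebraMap (X₁.presheaf.stalk (ζs i)) (blowupAlgebra (Ideal.span (Set.range d)) (d j))).comp
              ((X₁.presheaf.germ ⊤ (ζs i) trivial).hom.comp (f₁.appTop.hom.comp (Scheme.ΓSpecIso (.of k)).inv.hom))))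
          p hp.out.ne_zero
      haveI := hregB j 𝔔
      exact FiClauseOfRegular.stub_fiClauseOfRegular p _
    · have h := hVB P' (by rw [hgerm]; exact hP')
      rwa [hJ] at h

/-! ## §4 `clusterGrowth_multi`: the simultaneous dominating cure, arena form -/

/-- **`clusterGrowth_multi` — the SIMULTANEOUS DOMINATING CURE at finitely many points** (res-L1-w45a-tri-2 22:34:36Z / R16.54 (2), arena form):
`J₀ ≠ ⊥` good over `S`; `ζ₁,…,ζ_m` in one affine open `U₀`, all of local dimension `≤ 3`, one of local dimension `3`; `T ⊇ Sing X₁ ∪ NonPrinc J₀` any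
closed STABLE ARENA. Then ONE auxiliary centre `J″ ≠ ⊥` with `supp J″ ⊆ T` and ONE open `U ∋ ζ₁,…,ζ_m` such that every blowing up along `J₀ · J″`
is FULL over `U` and `GoodOver p X₁ (J₀ · J″) ((S ∖ T) ∪ U)` — each ROUND cures all the given points at once; new bad set `⊆ (old ∖ U) ∪ (T ∖ U)`.
Modulo CP 2019 Thm. 1.1 + Raynaud–Gruson + CP 2019 Prop. 4.4 (ONE semi-local application) and `NonFullLocusClosed` BY NAME.
[OURS · conditional-result] [cite: CossartPiltant2019, Thm. 1.1 (i)(ii); Prop. 4.4] [cite: DattaMurayama2024, Thm. B]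
[cite: StacksProject, Tag 0804; Tag 0805; Tag 01J7] -/
theorem clusterGrowth_multi
    (hG : CossartPiltant2019General.{0}) (h081R : Stacks081R.{0}) (hP4 : CossartPiltant2019Principalization.{0})
    (hNF : NonFullLocusClosed.NonFullLocusClosed)
    (p : ℕ) (hp : p.Prime) (k : Type) [Field k] [CharP k p] (X₁ : Scheme.{0}) (f₁ : X₁ ⟶ Spec (.of k))
    [LocallyOfFiniteType f₁] [QuasiCompact f₁] [IsIntegral X₁]
    (J₀ : X₁.IdealSheafData) (hJ₀ : J₀ ≠ ⊥) (S : Set X₁) (hS : GoodOver p X₁ J₀ S)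
    {m : ℕ} (ζs : Fin m → X₁) (U₀ : X₁.affineOpens) (hζ : ∀ i, ζs i ∈ (U₀ : X₁.Opens))
    (hle : ∀ i, ringKrullDim (X₁.presheaf.stalk (ζs i)) ≤ 3) (h3 : ∃ i, ringKrullDim (X₁.presheaf.stalk (ζs i)) = 3)
    (T : Set X₁) (hT : IsClosed T) (hsub : (Scheme.regularLocus X₁)ᶜ ∪ {y | ¬ IsLocallyPrincipalAt J₀ y} ⊆ T) :
    ∃ (J'' : X₁.IdealSheafData) (U : X₁.Opens), J'' ≠ ⊥ ∧ (J''.support : Set X₁) ⊆ T ∧ (∀ i, ζs i ∈ (U : Set X₁)) ∧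
      (∀ (X₂ : Scheme.{0}) (π : X₂ ⟶ X₁), IsBlowup π (J₀ * J'') → ∀ x : X₂, π.base x ∈ (U : Set X₁) → FullCl p (X₂.presheaf.stalk x)) ∧
      GoodOver p X₁ (J₀ * J'') ((S \ T) ∪ (U : Set X₁)) := by
  classical
  haveI : Fact p.Prime := ⟨hp⟩
  haveI : IsNoetherian X₁ := ClosedPointsOfClosedFinite.isNoetherian_of_locallyOfFiniteType_of_quasiCompact f₁
  haveI : JacobsonSpace X₁ := LocallyOfFiniteType.jacobsonSpace f₁
  obtain ⟨i₀, -⟩ := id h3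
  obtain ⟨𝔮₀, h𝔮₀, hfix⟩ := exists_semiLocal_productCompatible_locFix hG h081R hP4 p f₁ ζs U₀ hζ hle h3 J₀ hJ₀
  -- `hrad` at each `ζᵢ`, from the support clause through generators of `𝔮₀`
  haveI : IsNoetherianRing Γ(X₁, U₀) := IsLocallyNoetherian.component_noetherian U₀
  obtain ⟨m₀, q, hq⟩ := Submodule.fg_iff_exists_fin_generating_family.mp (IsNoetherian.noetherian 𝔮₀)
  have hq' : Ideal.span (Set.range q) = 𝔮₀ := hq
  have hspan : ∀ i, Ideal.span (Set.range ((X₁.presheaf.germ U₀ (ζs i) (hζ i)).hom ∘ q)) =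
      𝔮₀.map (X₁.presheaf.germ U₀ (ζs i) (hζ i)).hom := fun i => by
    rw [BlowupChartLocalization.span_range_comp_eq_map, hq']
  have hrad : ∀ i, stalkIdeal (vanishingIdeal ⟨T, hT⟩) (ζs i) ≤ (𝔮₀.map (X₁.presheaf.germ U₀ (ζs i) (hζ i)).hom).radical := fun i => by
    rw [← hspan i]
    refine ClusterGrowthStepDimThree.hrad_of_support_clause (ζs i) J₀ _ (fun P' hP' => ?_) T hT hsub
    exact (hfix i).2 P' (by rw [← hspan i]; exact hP')
  -- ONE spread of `𝔮₀` with the prescribed stalks at all `ζᵢ` and support in `T` (stub-2)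
  have h0 : 𝔮₀.map (X₁.presheaf.germ U₀ (ζs i₀) (hζ i₀)).hom ≠ ⊥ := by
    rw [Ne, Ideal.map_eq_bot_iff_of_injective (germ_injective_of_isIntegral X₁ (ζs i₀) (hζ i₀))]
    exact h𝔮₀
  obtain ⟨J'', hJ'', hJ''ζ, hJ''T⟩ := SpreadMulti.exists_spread_multi X₁ U₀ 𝔮₀ T hT ζs hζ hrad i₀ h0
  have hprod : J₀ * J'' ≠ ⊥ := by
    intro h0'
    have h1 : stalkIdeal (J₀ * J'') (ζs i₀) = ⊥ := by rw [h0']; exact stalkIdeal_bot _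
    rw [stalkIdeal_mul] at h1
    rcases Ideal.mul_eq_bot.mp h1 with h | h
    · exact stalkIdeal_ne_bot_of_ne_bot hJ₀ _ h
    · exact stalkIdeal_ne_bot_of_ne_bot hJ'' _ h
  -- at each `ζᵢ`: FULL charts of `(J₀ · J″)_ζᵢ = J₀,ζᵢ · 𝔮₀𝒪_ζᵢ` ⇒ an open `Uᵢ ∋ ζᵢ` over which every blowing up along `J₀ · J″` is good
  have hU : ∀ i, ∃ U : X₁.Opens, ζs i ∈ (U : Set X₁) ∧
      (∀ (X₂ : Scheme.{0}) (π : X₂ ⟶ X₁), IsBlowup π (J₀ * J'') → ∀ x : X₂, π.base x ∈ (U : Set X₁) → FullCl p (X₂.presheaf.stalk x)) ∧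
      GoodOver p X₁ (J₀ * J'') (U : Set X₁) := fun i => by
    obtain ⟨n, d, hd, hfull⟩ := (hfix i).1
    have hdζ : Ideal.span (Set.range d) = stalkIdeal (J₀ * J'') (ζs i) := by rw [stalkIdeal_mul, hJ''ζ i, hd]
    exact DominatingLocFix.goodOver_nhd_of_locGood hNF p hp k X₁ f₁ (J₀ * J'') hprod (ζs i) d hdζ (fun j 𝔔 _ => (hfull j 𝔔).2)
  choose U hζU hUfull hUgood using hU
  refine ⟨J'', ⨆ i, U i, hJ'', hJ''T, fun i => ?_, fun X₂ π hπ x hx => ?_, ?_⟩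
  · rw [Opens.coe_iSup]
    exact Set.mem_iUnion.mpr ⟨i, hζU i⟩
  · rw [Opens.coe_iSup] at hx
    obtain ⟨i, hi⟩ := Set.mem_iUnion.mp hx
    exact hUfull i X₂ π hπ x hi
  · have hsub' : S \ T ⊆ S \ (J''.support : Set X₁) := fun x hx => ⟨hx.1, fun h => hx.2 (hJ''T h)⟩
    have h1 : GoodOver p X₁ (J₀ * J'') (S \ T) :=
      RelClosedSubsetFixFinite.goodOver_mono hsub' (GoodOverMul.goodOver_mul_diff_support hS)
    have h2 : GoodOver p X₁ (J₀ * J'') ((⨆ i, U i : X₁.Opens) : Set X₁) := by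
      rw [Opens.coe_iSup]
      exact goodOver_iUnion hUgood
    exact RelClosedFixR.goodOver_union h1 h2

/-- `clusterGrowth_multi` from the FIVE printed theorems BY NAME (CP 2019 Thm. 1.1; Raynaud–Gruson 1971 Thm. 5.2.2; CP 2019 Prop. 4.4;
Datta–Murayama 2024 Thm. B; openness of the Cohen–Macaulay locus EGA IV₂ 6.11.2). [OURS · conditional-result] -/
theorem clusterGrowth_multi_of_named
    (hG : CossartPiltant2019General.{0}) (h081R : Stacks081R.{0}) (hP4 : CossartPiltant2019Principalization.{0})
    (hDM : Literature.AlgebraicGeometry.Resolution.DattaMurayama2024_fInjectiveLocusOpen.{0})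
    (hCMo : NonFullLocusClosed.CMLocusOpen)
    (p : ℕ) (hp : p.Prime) (k : Type) [Field k] [CharP k p] (X₁ : Scheme.{0}) (f₁ : X₁ ⟶ Spec (.of k))
    [LocallyOfFiniteType f₁] [QuasiCompact f₁] [IsIntegral X₁]
    (J₀ : X₁.IdealSheafData) (hJ₀ : J₀ ≠ ⊥) (S : Set X₁) (hS : GoodOver p X₁ J₀ S)
    {m : ℕ} (ζs : Fin m → X₁) (U₀ : X₁.affineOpens) (hζ : ∀ i, ζs i ∈ (U₀ : X₁.Opens))
    (hle : ∀ i, ringKrullDim (X₁.presheaf.stalk (ζs i)) ≤ 3) (h3 : ∃ i, ringKrullDim (X₁.presheaf.stalk (ζs i)) = 3)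
    (T : Set X₁) (hT : IsClosed T) (hsub : (Scheme.regularLocus X₁)ᶜ ∪ {y | ¬ IsLocallyPrincipalAt J₀ y} ⊆ T) :
    ∃ (J'' : X₁.IdealSheafData) (U : X₁.Opens), J'' ≠ ⊥ ∧ (J''.support : Set X₁) ⊆ T ∧ (∀ i, ζs i ∈ (U : Set X₁)) ∧
      (∀ (X₂ : Scheme.{0}) (π : X₂ ⟶ X₁), IsBlowup π (J₀ * J'') → ∀ x : X₂, π.base x ∈ (U : Set X₁) → FullCl p (X₂.presheaf.stalk x)) ∧
      GoodOver p X₁ (J₀ * J'') ((S \ T) ∪ (U : Set X₁)) :=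
  clusterGrowth_multi hG h081R hP4 (NonFullLocusClosed.nonFullLocusClosed_of_named hDM hCMo) p hp k X₁ f₁ J₀ hJ₀ S hS ζs U₀ hζ hle h3 T hT hsub

end Summit.ResolutionOfSingularities.ResolutionOfSingularities.Theorems.FInjectiveMacaulayfication.ClusterGrowthMulti

end
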